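import Mathlib

/-!
# Tier3FockHomogeneity — «each homogeneous of degree `q = 1` in its own Fock variables hence `U(W_i)`-eigen, so it
spans a CHARACTER» (T3.5 for T3.1; PERIOD.md §4.5 (α), the purity clause)

Blind re-derivation cell `pub-hodge-repro`, seat `t3-p1` (Tier 3, T3.5 Lean item beside T3.1). Target tree path
`lean/Summits/Ventures/HodgeRepro/Tier3FockHomogeneity.lean`; Mathlib only; theorems only (no definition, instance,
notation or macro). The glue sentence t3-p1 g16 left named in its HANDOFF as the other un-twinned elementary clause
(«cite-only classical + FockWedge — I read it as glue»), weighed and filed by g17: Mathlib has the homogeneity API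
(`MvPolynomial.IsHomogeneous`) but NOT the scaling identity itself — the `U(1)`-weight of a homogeneous polynomial is
its degree — so the sentence is on the kernel only through this file.

`proofs/t3-p1/PERIOD.md` §4.5 (α): «at `w₀` the KM form `φ^{(2q,0)} = φ^{(q,0)} ∧ φ^{(q,0)}` (Bergeron Thm 1.1 …) is a
product of two line-forms, each homogeneous of degree `q = 1` in its own Fock variables hence `U(W_i)`-eigen, so it
spans a CHARACTER `σ₀(w₀) = det^k` of `U(2)`». Vocabulary: the Fock model of the line `W_i` is the polynomial ring in
the variables `σᵢ` (coefficients `R`, `ℂ` in the application); the centre `U(W_i) = U(1)` acts on the variables by the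
scalar `z`, i.e. on a polynomial by the substitution `x ↦ z • x`; a line-form of degree `q` is a polynomial
`φ` with `φ.IsHomogeneous q`; the two lines together have the variables `σ₁ ⊕ σ₂`, the torus `U(W₁) × U(W₂)` acts by
`(z₁, z₂)`, and the product of the two line-forms is `rename Sum.inl φ₁ * rename Sum.inr φ₂` (FockWedge carries the
exterior-algebra side; this file is the polynomial side). One theorem per clause:

* `eval_smul_of_isHomogeneous` — THE WEIGHT IS THE DEGREE: `φ.IsHomogeneous n` gives `eval (c • x) φ = c ^ n * eval x φ`
  (a homogeneous polynomial of degree `n` is an eigenvector of the scalar action with the character `z ↦ z^n`);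
* `eval_smul_of_isHomogeneous_one` — «homogeneous of degree `q = 1` … hence `U(W_i)`-eigen», with the identity
  character;
* `eval_mul_smul_of_isHomogeneous` — a product of forms homogeneous of degrees `m`, `n` in the SAME variables has
  weight `m + n`;
* `eval_prod_smul_of_isHomogeneous` — a product of `b` line-forms of degree `q` each (the `ψ_{bq,0}` shape) has
  weight `b · q`;
* `eval_rename_inl_smul` / `eval_rename_inr_smul` — a form in the variables of ONE line is acted on only by ITS
  `U(W_i)`: the other factor of the torus is invisible («in its own Fock variables»);
* `eval_two_lines_smul` — THE PRODUCT OF TWO LINE-FORMS of degrees `n₁`, `n₂` in their own variables is an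
  eigenvector of the torus `U(W₁) × U(W₂)` with the character `(z₁, z₂) ↦ z₁^{n₁} z₂^{n₂}`;
* `eval_two_lines_smul_one` — for `q = 1`: the character `(z₁, z₂) ↦ z₁ z₂` («so it spans a CHARACTER»; that this
  character of the torus is the restriction of `det^k` of `U(2)` — `k = 1` in this bookkeeping, the shift being the
  KK Lemma 5.3 caveat — is the page's Howe-duality reading, not this file's);
* `eval_two_lines_smul_eq_of_degree_eq` — two such products with the SAME bidegree are eigen for the SAME character
  (the weight space of the torus is spanned by them: «(iv) the `T_v`-weight spaces … are one-dimensional» is the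
  page's, its kernel shadow is that equal bidegrees give equal characters).

What stays on the page: the Fock model itself (the Schrödinger–Fock intertwiner, Howe duality for the compact pair —
Kashiwara–Vergne / Howe, cite-only), the identification of the scalar action of `U(1) ⊂ U(W_i)` with the action on
the Fock variables, the KM form as the product of two line-forms (Bergeron Thm 1.1 / Thm 3.4 as PERIOD.md cites them)
and the `det^k` reading of the torus character (Konno–Konno Lemma 5.3). Nothing here is about theta lifts or
`L`-values; HC_CM is NOT proved by anyone in this repository.
-/

set_option autoImplicit false

namespace HodgeRepro.T3P1.FockHomogeneity

open MvPolynomial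

section OneLine

variable {σ R : Type*} [CommSemiring R]

/-- **The weight is the degree.** A polynomial homogeneous of degree `n` is an eigenvector of the scalar substitution
`x ↦ c • x` with eigenvalue `c ^ n`: `eval (c • x) φ = c ^ n * eval x φ` (PERIOD.md §4.5 (α): «homogeneous of degree
`q` in its own Fock variables hence `U(W_i)`-eigen»). -/
theorem eval_smul_of_isHomogeneous {φ : MvPolynomial σ R} {n : ℕ} (hφ : φ.IsHomogeneous n) (c : R)
    (x : σ → R) : eval (c • x) φ = c ^ n * eval x φ := by
  rw [eval_eq, eval_eq, Finset.mul_sum]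
  refine Finset.sum_congr rfl fun d hd => ?_
  have hdeg : n = ∑ i ∈ d.support, d i := hφ.degree_eq_sum_deg_support hd
  have hprod : ∏ i ∈ d.support, (c • x) i ^ d i = c ^ n * ∏ i ∈ d.support, x i ^ d i := by
    simp only [Pi.smul_apply, smul_eq_mul, mul_pow, Finset.prod_mul_distrib,
      Finset.prod_pow_eq_pow_sum, hdeg]
  rw [hprod, mul_left_comm]

/-- **Degree one: the identity character.** «Each homogeneous of degree `q = 1` in its own Fock variables hence
`U(W_i)`-eigen»: `eval (c • x) φ = c * eval x φ`. -/
theorem eval_smul_of_isHomogeneous_one {φ : MvPolynomial σ R} (hφ : φ.IsHomogeneous 1) (c : R) (x : σ → R) :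
    eval (c • x) φ = c * eval x φ := by
  rw [eval_smul_of_isHomogeneous hφ c x, pow_one]

/-- A product of two forms homogeneous of degrees `m` and `n` in the same variables has weight `m + n`. -/
theorem eval_mul_smul_of_isHomogeneous {φ ψ : MvPolynomial σ R} {m n : ℕ} (hφ : φ.IsHomogeneous m)
    (hψ : ψ.IsHomogeneous n) (c : R) (x : σ → R) :
    eval (c • x) (φ * ψ) = c ^ (m + n) * eval x (φ * ψ) := by
  rw [eval_mul, eval_mul, eval_smul_of_isHomogeneous hφ c x, eval_smul_of_isHomogeneous hψ c x, pow_add]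
  ring

/-- A product of `b` line-forms (indexed by `s`), each homogeneous of degree `q`, has weight `b · q`
(the `ψ_{bq,0}` shape of the KM cocycle). -/
theorem eval_prod_smul_of_isHomogeneous {ι : Type*} (s : Finset ι) (φ : ι → MvPolynomial σ R) (q : ℕ)
    (hφ : ∀ i ∈ s, (φ i).IsHomogeneous q) (c : R) (x : σ → R) :
    eval (c • x) (∏ i ∈ s, φ i) = c ^ (s.card * q) * eval x (∏ i ∈ s, φ i) := by
  have h : (∏ i ∈ s, φ i).IsHomogeneous (∑ i ∈ s, q) :=
    IsHomogeneous.prod s φ (fun _ => q) hφ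
  rw [eval_smul_of_isHomogeneous h c x, Finset.sum_const, smul_eq_mul]

end OneLine

section TwoLines

variable {σ₁ σ₂ R : Type*} [CommSemiring R]

/-- A form in the variables of the FIRST line only sees the first factor of the torus: evaluating
`rename Sum.inl φ₁` at `Sum.elim (z₁ • x₁) (z₂ • x₂)` is evaluating `φ₁` at `z₁ • x₁`. -/
theorem eval_rename_inl_smul (φ₁ : MvPolynomial σ₁ R) (z₁ z₂ : R) (x₁ : σ₁ → R) (x₂ : σ₂ → R) :
    eval (Sum.elim (z₁ • x₁) (z₂ • x₂)) (rename Sum.inl φ₁) = eval (z₁ • x₁) φ₁ := by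
  rw [eval_rename, Sum.elim_comp_inl]

/-- A form in the variables of the SECOND line only sees the second factor of the torus. -/
theorem eval_rename_inr_smul (φ₂ : MvPolynomial σ₂ R) (z₁ z₂ : R) (x₁ : σ₁ → R) (x₂ : σ₂ → R) :
    eval (Sum.elim (z₁ • x₁) (z₂ • x₂)) (rename Sum.inr φ₂) = eval (z₂ • x₂) φ₂ := by
  rw [eval_rename, Sum.elim_comp_inr]

/-- **The product of two line-forms is an eigenvector of the torus.** For `φ₁` homogeneous of degree `n₁` in the
variables of `W₁` and `φ₂` homogeneous of degree `n₂` in those of `W₂`, the product `rename Sum.inl φ₁ *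
rename Sum.inr φ₂` is an eigenvector of `(z₁, z₂) ∈ U(W₁) × U(W₂)` with the character `z₁^{n₁} z₂^{n₂}`. -/
theorem eval_two_lines_smul {φ₁ : MvPolynomial σ₁ R} {φ₂ : MvPolynomial σ₂ R} {n₁ n₂ : ℕ}
    (h₁ : φ₁.IsHomogeneous n₁) (h₂ : φ₂.IsHomogeneous n₂) (z₁ z₂ : R) (x₁ : σ₁ → R) (x₂ : σ₂ → R) :
    eval (Sum.elim (z₁ • x₁) (z₂ • x₂)) (rename Sum.inl φ₁ * rename Sum.inr φ₂) =
      z₁ ^ n₁ * z₂ ^ n₂ * eval (Sum.elim x₁ x₂) (rename Sum.inl φ₁ * rename Sum.inr φ₂) := by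
  rw [eval_mul, eval_mul, eval_rename_inl_smul, eval_rename_inr_smul, eval_rename, eval_rename,
    Sum.elim_comp_inl, Sum.elim_comp_inr, eval_smul_of_isHomogeneous h₁ z₁ x₁,
    eval_smul_of_isHomogeneous h₂ z₂ x₂]
  ring

/-- **Degree `(1, 1)`: the character `(z₁, z₂) ↦ z₁ z₂`.** «Each homogeneous of degree `q = 1` in its own Fock
variables hence `U(W_i)`-eigen, so it spans a CHARACTER» — the product of two degree-one line-forms is an eigenvector
of the torus with the character `z₁ z₂` (the restriction of `det` of `U(2)` to its diagonal torus). -/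
theorem eval_two_lines_smul_one {φ₁ : MvPolynomial σ₁ R} {φ₂ : MvPolynomial σ₂ R}
    (h₁ : φ₁.IsHomogeneous 1) (h₂ : φ₂.IsHomogeneous 1) (z₁ z₂ : R) (x₁ : σ₁ → R) (x₂ : σ₂ → R) :
    eval (Sum.elim (z₁ • x₁) (z₂ • x₂)) (rename Sum.inl φ₁ * rename Sum.inr φ₂) =
      z₁ * z₂ * eval (Sum.elim x₁ x₂) (rename Sum.inl φ₁ * rename Sum.inr φ₂) := by
  rw [eval_two_lines_smul h₁ h₂ z₁ z₂ x₁ x₂, pow_one, pow_one]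

/-- **Equal bidegrees, equal characters.** Two products of line-forms of the same bidegree `(n₁, n₂)` transform by
the same character of the torus — the kernel shadow of «the `T_v`-weight spaces … are one-dimensional»: the torus
cannot tell two such products apart by its action. -/
theorem eval_two_lines_smul_eq_of_degree_eq {φ₁ ψ₁ : MvPolynomial σ₁ R} {φ₂ ψ₂ : MvPolynomial σ₂ R} {n₁ n₂ : ℕ}
    (hφ₁ : φ₁.IsHomogeneous n₁) (hφ₂ : φ₂.IsHomogeneous n₂) (hψ₁ : ψ₁.IsHomogeneous n₁)
    (hψ₂ : ψ₂.IsHomogeneous n₂) (z₁ z₂ : R) (x₁ : σ₁ → R) (x₂ : σ₂ → R)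
    (hx : eval (Sum.elim x₁ x₂) (rename Sum.inl φ₁ * rename Sum.inr φ₂) =
      eval (Sum.elim x₁ x₂) (rename Sum.inl ψ₁ * rename Sum.inr ψ₂)) :
    eval (Sum.elim (z₁ • x₁) (z₂ • x₂)) (rename Sum.inl φ₁ * rename Sum.inr φ₂) =
      eval (Sum.elim (z₁ • x₁) (z₂ • x₂)) (rename Sum.inl ψ₁ * rename Sum.inr ψ₂) := by
  rw [eval_two_lines_smul hφ₁ hφ₂ z₁ z₂ x₁ x₂, eval_two_lines_smul hψ₁ hψ₂ z₁ z₂ x₁ x₂, hx]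

end TwoLines

end HodgeRepro.T3P1.FockHomogeneity
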